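import Literature.NumberTheory.QuadraticFields.IdealClassInverse
import Literature.NumberTheory.QuadraticFields.GenusCharacterValues
import Literature.NumberTheory.QuadraticFields.LenstraPomeranceAmbiguousFormsPairs
import Literature.NumberTheory.QuadraticFields.FundamentalDiscriminant
import HarnessLib

/-!
# The 2-torsion of the class group of an imaginary quadratic field: `|Cl_K[2]| = 2^{t−1}`

Topic `NumberTheory/QuadraticFields`, namespace `Literature.NumberTheory.QuadraticFields.Quadratic`.
Everything here is PROVED (theorems only; no definitions, no named facts).

Let `K` be an imaginary quadratic field of discriminant `d = d_K` with `t` distinct prime divisors.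
Gauss: the classes `C ∈ Cl_K` with `C² = 1` ("ambiguous classes") number exactly `2^{t−1}`
(Cox, *Primes of the form x² + ny²*, Prop. 3.11 / Thm. 3.15; Lenstra–Pomerance 1992, (2.4) and
Thm. 2.5 for the count of ambiguous reduced forms).  We prove it through the tree's bijection
`reducedForms d_K ≃ Cl_K`, `Q = (A, B, C) ↦ [𝔞_Q]` (`reducedForms_mk0_bijective`), the inverse
`[𝔞_{(A,−B,C)}] = [𝔞_Q]⁻¹` (`mk0_formIdeal_neg_eq_inv`) and the elementary fact that a reduced
form is equivalent to its opposite iff it has one of the three **ambiguous shapes** `B = 0`,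
`B = A`, `A = C` (LP (2.4)):

* `span_formIdeal_diag_neg_eq` — `𝔞_{(A,−A,C)} = 𝔞_{(A,A,C)}` (equal ideals);
* `mk0_formIdeal_outer_neg_eq` — `[𝔞_{(A,−B,A)}] = [𝔞_{(A,B,A)}]` (`(ω − k)·𝔞_{(A,−B,A)} = (A)·𝔞_{(A,B,A)}`);
* `neg_mem_reducedForms_of_not_ambiguous` — a reduced form with none of the three shapes has a
  reduced opposite `(A, −B, C) ≠ (A, B, C)`;
* `sq_mk0_formIdeal_eq_one_iff` — **`[𝔞_Q]² = 1 ↔ Q` has an ambiguous shape** (`Q` reduced);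
* `card_sq_eq_one_eq_card_filter_ambiguous` — `|Cl_K[2]| = #{Q reduced of discriminant d_K ambiguous}`;
* `card_filter_ambiguous_reducedForms_discr` — that number is `2^{t−1}` for the (fundamental)
  discriminant of a quadratic field (assembling the tree's Lenstra–Pomerance counts
  `card_filter_ambiguous_eq`, `card_ambPairs_of_mod_four_eq_three`, `card_ambPairs_four_mul`,
  `ambPairs_eq_empty_of_mod_sixteen_eq_eight`, `card_filter_coprime_*_divisorsAntidiagonal`);
* `card_sq_eq_one_classGroup` — **`|{C ∈ Cl_K : C² = 1}| = 2^{t−1}`**, `t = ω(|d_K|)`.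

This is the class-group half of Gauss's genus theory (the number of genera is `2^{t−1}`), used to
show that the genus characters exhaust the real characters of `Cl_K`.

## References

* [Cox2013] D. A. Cox, *Primes of the form x² + ny²*, 2nd ed. (2013), §3.B Prop. 3.11, Thm. 3.15;
  §7.B Thm. 7.7.
* [LenstraPomerance1992] H. W. Lenstra Jr., C. Pomerance, *A rigorous time bound for factoring
  integers*, J. Amer. Math. Soc. 5 (1992), §2 (2.4) and Theorem 2.5.
-/

noncomputable section

open scoped nonZeroDivisors
open Module NumberField Finset
open Literature.NumberTheory.EllipticCurves
open Literature.NumberTheory.QuadraticFields.BinaryQuadraticForm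

namespace Literature.NumberTheory.QuadraticFields.Quadratic

/-! ### The three ambiguous shapes and the opposite form -/

section Forms

variable {K : Type*} [Field K] [NumberField K]

omit [NumberField K] in
/-- **`𝔞_{(A,−A,C)} = 𝔞_{(A,A,C)}`**: the two generators `ω − (±A + t)/2` differ by `A`. [folklore] -/
theorem span_formIdeal_diag_neg_eq (b : Basis (Fin 2) ℤ (𝓞 K)) {t m A C : ℤ}
    (hdisc : A ^ 2 - 4 * A * C = t ^ 2 + 4 * m) :
    Ideal.span {(A : 𝓞 K), b 1 - (((-A + t) / 2 : ℤ) : 𝓞 K)} =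
      Ideal.span {(A : 𝓞 K), b 1 - (((A + t) / 2 : ℤ) : 𝓞 K)} := by
  have hdisc' : (-A) ^ 2 - 4 * A * C = t ^ 2 + 4 * m := by rw [neg_sq]; exact hdisc
  have h1 : 2 * ((A + t) / 2) = A + t := two_mul_ediv_two_of_disc_eq hdisc
  have h2 : 2 * ((-A + t) / 2) = -A + t := two_mul_ediv_two_of_disc_eq hdisc'
  have hk : (A + t) / 2 = (-A + t) / 2 + A := by omega
  rw [hk, Int.cast_add]
  have e : b 1 - ((((-A + t) / 2 : ℤ) : 𝓞 K) + (A : 𝓞 K)) =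
      (b 1 - (((-A + t) / 2 : ℤ) : 𝓞 K)) + (-1) * (A : 𝓞 K) := by ring
  rw [e, Ideal.span_pair_add_mul_left]

/-- **`[𝔞_{(A,−B,A)}] = [𝔞_{(A,B,A)}]`**: with `k = (B+t)/2`, `k' = (−B+t)/2 = t − k` one has
`(ω − k)(ω − k') = −A²`, whence `(ω − k) 𝔞_{(A,−B,A)} = (A(ω−k), A²) = (A) 𝔞_{(A,B,A)}`.
[cite: Cox2013, §7.B Thm. 7.7] -/
theorem mk0_formIdeal_outer_neg_eq (b : Basis (Fin 2) ℤ (𝓞 K)) (hb : b 0 = 1) {t m : ℤ}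
    (hω : b 1 * b 1 = (m : 𝓞 K) + (t : 𝓞 K) * b 1) {A B : ℤ} (hA : A ≠ 0)
    (hdisc : B ^ 2 - 4 * A * A = t ^ 2 + 4 * m)
    (h𝔞 : Ideal.span {(A : 𝓞 K), b 1 - (((B + t) / 2 : ℤ) : 𝓞 K)} ∈ (Ideal (𝓞 K))⁰)
    (h𝔞' : Ideal.span {(A : 𝓞 K), b 1 - (((-B + t) / 2 : ℤ) : 𝓞 K)} ∈ (Ideal (𝓞 K))⁰) :
    ClassGroup.mk0 ⟨_, h𝔞'⟩ = ClassGroup.mk0 ⟨_, h𝔞⟩ := by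
  set k : ℤ := (B + t) / 2 with hk
  set k' : ℤ := (-B + t) / 2 with hk'
  have hdisc' : (-B) ^ 2 - 4 * A * A = t ^ 2 + 4 * m := by rw [neg_sq]; exact hdisc
  have h2k : 2 * k = B + t := two_mul_ediv_two_of_disc_eq hdisc
  have h2k' : 2 * k' = -B + t := two_mul_ediv_two_of_disc_eq hdisc'
  have hkk' : k' = t - k := by omega
  have hn : A * A = k ^ 2 - t * k - m := norm_eq_of_disc_eq hdisc h2k
  -- the key element identity
  have hprod : (b 1 - (k : 𝓞 K)) * (b 1 - (k' : 𝓞 K)) = -((A : 𝓞 K) * A) := by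
    have hn' : ((A : 𝓞 K)) * A = (k : 𝓞 K) ^ 2 - t * k - m := by exact_mod_cast congrArg (Int.cast (R := 𝓞 K)) hn
    rw [hkk', Int.cast_sub]
    linear_combination hω + hn'
  rw [ClassGroup.mk0_eq_mk0_iff]
  refine ⟨b 1 - (k : 𝓞 K), (A : 𝓞 K), ?_, fun h ↦ hA (intCast_eq_zero_of_basis b hb h), ?_⟩
  · intro h0
    have : (b 1 - (k : 𝓞 K)) * (b 1 - (k' : 𝓞 K)) = 0 := by rw [h0, zero_mul]
    rw [hprod, neg_eq_zero, mul_self_eq_zero] at this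
    exact hA (intCast_eq_zero_of_basis b hb this)
  · show Ideal.span {b 1 - (k : 𝓞 K)} * Ideal.span {(A : 𝓞 K), b 1 - (k' : 𝓞 K)} =
      Ideal.span {(A : 𝓞 K)} * Ideal.span {(A : 𝓞 K), b 1 - (k : 𝓞 K)}
    rw [Ideal.span_insert, Ideal.span_insert, Ideal.mul_sup, Ideal.mul_sup,
      Ideal.span_singleton_mul_span_singleton, Ideal.span_singleton_mul_span_singleton,
      Ideal.span_singleton_mul_span_singleton, Ideal.span_singleton_mul_span_singleton, hprod,
      Ideal.span_singleton_neg, mul_comm (b 1 - (k : 𝓞 K)) (A : 𝓞 K), sup_comm]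

/-- A reduced form with none of the three ambiguous shapes has `0 < |B| < A < C`, so its opposite
`(A, −B, C)` is again reduced, and different from it. [cite: LenstraPomerance1992, §2 (2.4)] -/
theorem neg_mem_reducedForms_of_not_ambiguous {D : ℤ} (hD : D < 0) {Q : ℤ × ℤ × ℤ}
    (hQ : Q ∈ reducedForms D) (hamb : ¬ (Q.2.1 = 0 ∨ Q.2.1 = Q.1 ∨ Q.1 = Q.2.2)) :
    (Q.1, -Q.2.1, Q.2.2) ∈ reducedForms D ∧ (Q.1, -Q.2.1, Q.2.2) ≠ Q := by
  obtain ⟨A, B, C⟩ := Q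
  obtain ⟨hdisc, hA, hprim, hred⟩ := (mem_reducedForms_iff hD).1 hQ
  simp only at hamb hdisc hA hprim hred ⊢
  push Not at hamb
  obtain ⟨hB0, hBA, hAC⟩ := hamb
  obtain ⟨h1, h2, h3, h4⟩ := hred
  refine ⟨(mem_reducedForms_iff hD).2 ⟨?_, hA, isPrimitive_neg hprim, ?_⟩, ?_⟩
  · rw [discr_apply] at hdisc ⊢; rw [neg_sq]; exact hdisc
  · refine ⟨by simp only; linarith, by simp only; linarith, h3, ?_⟩
    simp only
    rintro (h | h | h)
    · exact absurd (by linarith : B = A) hBA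
    · have hB : B = -A := by linarith
      have := h4 (Or.inl hB)
      linarith
    · exact absurd h hAC
  · simp only [ne_eq, Prod.mk.injEq, true_and, and_true]
    intro h; exact hB0 (by linarith)

/-- **`[𝔞_Q]² = 1` iff `Q` has an ambiguous shape** (`B = 0`, `B = A` or `A = C`), for a reduced
form `Q` of discriminant `d_K = t² + 4m < 0` (`(1, ω)` an integral basis with `ω² = m + tω`):
`[𝔞_Q]⁻¹ = [𝔞_{(A,−B,C)}]`, which is `[𝔞_Q]` in the three shapes and is the class of a DIFFERENT
reduced form otherwise. [cite: Cox2013, §3.B Prop. 3.11] -/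
theorem sq_mk0_formIdeal_eq_one_iff (b : Basis (Fin 2) ℤ (𝓞 K)) (hb : b 0 = 1) {t m : ℤ}
    (hω : b 1 * b 1 = (m : 𝓞 K) + (t : 𝓞 K) * b 1) (hneg : t ^ 2 + 4 * m < 0)
    (Q : reducedForms (t ^ 2 + 4 * m)) :
    ClassGroup.mk0 ⟨_, formIdeal_mem_nonZeroDivisors b hb hneg Q⟩ ^ 2 = 1 ↔
      ((Q : ℤ × ℤ × ℤ).2.1 = 0 ∨ (Q : ℤ × ℤ × ℤ).2.1 = (Q : ℤ × ℤ × ℤ).1 ∨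
        (Q : ℤ × ℤ × ℤ).1 = (Q : ℤ × ℤ × ℤ).2.2) := by
  obtain ⟨⟨A, B, C⟩, hQ⟩ := Q
  obtain ⟨hdiscQ, hA, hprim, hred⟩ := (mem_reducedForms_iff hneg).1 hQ
  rw [discr_apply] at hdiscQ
  simp only at hdiscQ hA ⊢
  have hprim' : ∀ d : ℤ, d ∣ A → d ∣ B → d ∣ C → IsUnit d :=
    (BinQF.isPrimitive_iff ⟨A, B, C⟩).1 hprim
  have h𝔞 : Ideal.span {(A : 𝓞 K), b 1 - (((B + t) / 2 : ℤ) : 𝓞 K)} ∈ (Ideal (𝓞 K))⁰ :=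
    span_pair_mem_nonZeroDivisors b hb hA.ne' _
  have h𝔞' : Ideal.span {(A : 𝓞 K), b 1 - (((-B + t) / 2 : ℤ) : 𝓞 K)} ∈ (Ideal (𝓞 K))⁰ :=
    span_pair_mem_nonZeroDivisors b hb hA.ne' _
  have hinv := mk0_formIdeal_neg_eq_inv b hb hω hA.ne' hdiscQ hprim' h𝔞 h𝔞'
  have hmk : ClassGroup.mk0 ⟨_, formIdeal_mem_nonZeroDivisors b hb hneg ⟨(A, B, C), hQ⟩⟩ =
      ClassGroup.mk0 ⟨_, h𝔞⟩ := rfl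
  rw [hmk, sq, mul_eq_one_iff_eq_inv, ← hinv]
  constructor
  · -- `[𝔞_Q] = [𝔞_{Q⁻}]` forces an ambiguous shape
    intro heq
    by_contra hamb
    obtain ⟨hmem, hne⟩ := neg_mem_reducedForms_of_not_ambiguous hneg hQ hamb
    have hinj := (reducedForms_mk0_bijective b hb hω hneg).1
      (a₁ := ⟨(A, B, C), hQ⟩) (a₂ := ⟨(A, -B, C), hmem⟩) (by simpa using heq)
    exact hne (congrArg Subtype.val hinj).symm
  · rintro (h0 | hBA | hAC)
    · -- `B = 0`: the opposite form is the form
      have e : Ideal.span {(A : 𝓞 K), b 1 - (((-B + t) / 2 : ℤ) : 𝓞 K)} =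
          Ideal.span {(A : 𝓞 K), b 1 - (((B + t) / 2 : ℤ) : 𝓞 K)} := by rw [h0, neg_zero]
      exact congrArg ClassGroup.mk0 (Subtype.ext e.symm)
    · -- `B = A`: equal ideals
      have hdiscA : A ^ 2 - 4 * A * C = t ^ 2 + 4 * m := by rw [hBA] at hdiscQ; exact hdiscQ
      have e := span_formIdeal_diag_neg_eq b hdiscA
      have e' : Ideal.span {(A : 𝓞 K), b 1 - (((-B + t) / 2 : ℤ) : 𝓞 K)} =
          Ideal.span {(A : 𝓞 K), b 1 - (((B + t) / 2 : ℤ) : 𝓞 K)} := by rw [hBA]; exact e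
      exact congrArg ClassGroup.mk0 (Subtype.ext e'.symm)
    · -- `A = C`: `(ω − k) 𝔞_{Q⁻} = (A) 𝔞_Q`
      have hdiscAA : B ^ 2 - 4 * A * A = t ^ 2 + 4 * m := by
        nth_rewrite 2 [hAC]; exact hdiscQ
      exact (mk0_formIdeal_outer_neg_eq b hb hω hA.ne' hdiscAA h𝔞 h𝔞').symm

/-- **`|Cl_K[2]|` is the number of ambiguous reduced forms of discriminant `d_K`** (through the
bijection `reducedForms d_K ≃ Cl_K` and `sq_mk0_formIdeal_eq_one_iff`).
[cite: Cox2013, §3.B Prop. 3.11] -/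
theorem card_sq_eq_one_eq_card_filter_ambiguous (b : Basis (Fin 2) ℤ (𝓞 K)) (hb : b 0 = 1) {t m : ℤ}
    (hω : b 1 * b 1 = (m : 𝓞 K) + (t : 𝓞 K) * b 1) (hneg : t ^ 2 + 4 * m < 0) :
    Nat.card {c : ClassGroup (𝓞 K) // c ^ 2 = 1} =
      #{Q ∈ reducedForms (t ^ 2 + 4 * m) | Q.2.1 = 0 ∨ Q.2.1 = Q.1 ∨ Q.1 = Q.2.2} := by
  classical
  set F := Equiv.ofBijective _ (reducedForms_mk0_bijective b hb hω hneg) with hF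
  let amb : ℤ × ℤ × ℤ → Prop := fun Q ↦ Q.2.1 = 0 ∨ Q.2.1 = Q.1 ∨ Q.1 = Q.2.2
  have e1 : {Q : reducedForms (t ^ 2 + 4 * m) // amb Q} ≃ {c : ClassGroup (𝓞 K) // c ^ 2 = 1} :=
    F.subtypeEquiv fun Q ↦ (sq_mk0_formIdeal_eq_one_iff b hb hω hneg Q).symm
  have e2 : {Q : reducedForms (t ^ 2 + 4 * m) // amb Q} ≃
      ({Q ∈ reducedForms (t ^ 2 + 4 * m) | amb Q} : Finset _) :=
    { toFun := fun Q ↦ ⟨Q.1.1, mem_filter.2 ⟨Q.1.2, Q.2⟩⟩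
      invFun := fun Q ↦ ⟨⟨Q.1, (mem_filter.1 Q.2).1⟩, (mem_filter.1 Q.2).2⟩
      left_inv := fun Q ↦ rfl
      right_inv := fun Q ↦ rfl }
  rw [← Nat.card_congr e1, Nat.card_congr e2, Nat.card_eq_finsetCard]

end Forms

/-! ### The count `2^{t−1}` of ambiguous reduced forms of a fundamental discriminant -/

/-- `ω(4M) = ω(M) + 1` for odd `M`, `= ω(M)` for even `M ≠ 0`. [folklore] -/
theorem card_primeFactors_four_mul {M : ℕ} (hM : M ≠ 0) :
    (4 * M).primeFactors.card = if 2 ∣ M then M.primeFactors.card else M.primeFactors.card + 1 := by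
  have h4 : (4 : ℕ).primeFactors = {2} := by
    rw [show (4 : ℕ) = 2 ^ 2 by norm_num, Nat.primeFactors_prime_pow two_ne_zero Nat.prime_two]
  rw [Nat.primeFactors_mul (by norm_num) hM, h4]
  by_cases h2 : 2 ∣ M
  · rw [if_pos h2]
    have : ({2} : Finset ℕ) ∪ M.primeFactors = M.primeFactors :=
      Finset.union_eq_right.mpr (Finset.singleton_subset_iff.mpr
        (Nat.mem_primeFactors.mpr ⟨Nat.prime_two, h2, hM⟩))
    rw [this]
  · rw [if_neg h2, Finset.singleton_union (α := ℕ) 2, Finset.card_insert_of_notMem]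
    exact fun h ↦ h2 (Nat.dvd_of_mem_primeFactors h)

variable {K : Type*} [Field K] [NumberField K]

/-- **The number of ambiguous reduced forms of discriminant `d_K` is `2^{t−1}`**, `t = ω(|d_K|)`,
for the discriminant of a quadratic field (a fundamental discriminant `< 0`): by the shapes count
`#{B = 0} + #W(|d|)` (Lenstra–Pomerance (2.4)/Thm. 2.5): for odd `d`, `0 + 2^{ω(|d|)−1}`; for
`d = 4m`, `m ≡ 3 (mod 4)`, `2^{ω(|m|)−1} + 2^{ω(|m|)−1}` (`|m| > 1`; `1 + 0` for `d = −4`); for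
`d = 4m`, `m ≡ 2 (mod 4)`, `2^{ω(|m|)−1} + 0`. [cite: LenstraPomerance1992, §2 Theorem 2.5] -/
theorem card_filter_ambiguous_reducedForms_discr (h2 : finrank ℚ K = 2) (hneg : NumberField.discr K < 0) :
    #{Q ∈ reducedForms (NumberField.discr K) | Q.2.1 = 0 ∨ Q.2.1 = Q.1 ∨ Q.1 = Q.2.2} =
      2 ^ ((NumberField.discr K).natAbs.primeFactors.card - 1) := by
  set d : ℤ := NumberField.discr K with hd
  set D : ℕ := d.natAbs with hDdef
  have hDd : (D : ℤ) = -d := by rw [hDdef]; omega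
  rw [card_filter_ambiguous_eq hneg]
  rcases isFundamentalDiscriminant_discr (K := K) h2 with ⟨h1, -, -⟩ | ⟨h4, hm4, hsq⟩
  · -- odd discriminant: no `(a, 0, c)`, and `|d| ≡ 3 (mod 4)`
    have h4 : ¬ (4 : ℤ) ∣ d := by omega
    rw [card_filter_b_eq_zero_of_not_dvd hneg h4, zero_add]
    have hD3 : D % 4 = 3 := by omega
    have hD1 : 1 < D := by omega
    rw [card_ambPairs_of_mod_four_eq_three hD3, card_filter_coprime_lt_divisorsAntidiagonal hD1]
  · -- even discriminant `d = 4m`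
    set m' : ℤ := d / 4 with hm'
    have hdm : d = 4 * m' := by rw [hm', Int.mul_ediv_cancel' h4]
    set M : ℕ := m'.natAbs with hMdef
    have hm'neg : m' < 0 := by omega
    have hMm : (M : ℤ) = -m' := by rw [hMdef]; omega
    have hM0 : M ≠ 0 := by intro h; rw [h] at hMm; omega
    have hDM : D = 4 * M := by
      have : (D : ℤ) = 4 * M := by rw [hDd, hdm, hMm]; ring
      exact_mod_cast this
    have hD4 : D / 4 = M := by rw [hDM]; omega
    rw [card_filter_b_eq_zero hneg h4]
    change #{x ∈ (D / 4).divisorsAntidiagonal | Nat.Coprime x.1 x.2 ∧ x.1 ≤ x.2} +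
      #{x ∈ Icc 1 D ×ˢ Icc 1 D | x.1 < 2 * x.2 ∧ x.1 * (4 * x.2 - x.1) = D ∧ Nat.Coprime x.1 x.2} =
        2 ^ (D.primeFactors.card - 1)
    rw [hD4, hDM, card_primeFactors_four_mul hM0]
    rcases hm4 with hm2 | hm3
    · -- `m ≡ 2 (mod 4)`: `M ≡ 2 (mod 4)`, `D ≡ 8 (mod 16)`, no pairs
      have hM2 : M % 4 = 2 := by omega
      have hM2' : 2 ∣ M := by omega
      have hD16 : (4 * M) % 16 = 8 := by omega
      have hM1 : 1 < M := by omega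
      rw [ambPairs_eq_empty_of_mod_sixteen_eq_eight hD16, card_empty, add_zero, if_pos hM2',
        card_filter_coprime_le_divisorsAntidiagonal hM1]
    · -- `m ≡ 3 (mod 4)`: `M ≡ 1 (mod 4)`
      have hM1 : M % 4 = 1 := by omega
      have hM2' : ¬ 2 ∣ M := by omega
      rw [card_ambPairs_four_mul hM1, if_neg hM2', Nat.add_sub_cancel]
      by_cases hMone : M = 1
      · rw [hMone, card_filter_coprime_le_divisorsAntidiagonal_one,
          card_filter_coprime_lt_divisorsAntidiagonal_one]
        simp
      · have hM1' : 1 < M := by omega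
        rw [card_filter_coprime_le_divisorsAntidiagonal hM1',
          card_filter_coprime_lt_divisorsAntidiagonal hM1', ← two_mul, ← pow_succ']
        congr 1
        have : 0 < M.primeFactors.card := by
          rw [Finset.card_pos, Nat.nonempty_primeFactors]; exact hM1'
        omega

/-- **Gauss: the ambiguous classes of an imaginary quadratic field number `2^{t−1}`**, where `t`
is the number of distinct prime divisors of `d_K`: `|{C ∈ Cl_K : C² = 1}| = 2^{t−1}`.
[cite: Cox2013, §3.B Prop. 3.11 and Thm. 3.15] -/
theorem card_sq_eq_one_classGroup (hK : IsImaginaryQuadratic K) :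
    Nat.card {c : ClassGroup (𝓞 K) // c ^ 2 = 1} =
      2 ^ ((NumberField.discr K).natAbs.primeFactors.card - 1) := by
  obtain ⟨b, hb⟩ := exists_basis_zero_eq_one (K := K) hK.1
  set m : ℤ := b.repr (b 1 * b 1) 0 with hm
  set t : ℤ := b.repr (b 1 * b 1) 1 with ht
  have hω : b 1 * b 1 = (m : 𝓞 K) + (t : 𝓞 K) * b 1 := basis_one_mul_self_eq b hb
  have hDK : NumberField.discr K = t ^ 2 + 4 * m := discr_eq_sq_add_four_mul b hb
  have hneg : t ^ 2 + 4 * m < 0 := hDK ▸ hK.discr_neg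
  rw [card_sq_eq_one_eq_card_filter_ambiguous b hb hω hneg, ← hDK]
  exact card_filter_ambiguous_reducedForms_discr hK.1 hK.discr_neg

end Literature.NumberTheory.QuadraticFields.Quadratic

end
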